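import Literature.Geometry.Symplectic.JPlanePencilCapGraph
import Literature.Geometry.Symplectic.LeafCoordinateComplexLinearisation
import Mathlib.Analysis.Calculus.InverseFunctionTheorem.Deriv
import Mathlib.Analysis.Calculus.Deriv.Inverse
import HarnessLib

/-!
# The local intersection index of two pencil members at the constraint point

Support theorems (no named facts, D-0026) for
`Literature.Geometry.Symplectic.jPlanePencil_localFamily_homotopySphere`
(`JPlanePencilLocalFamily.lean`; C. Wendl, *Holomorphic Curves in Low Dimensions* (2018),
Prop. 2.53 with `m = 1`, for homotopy 4-spheres), continuing `JPlanePencilMemberCap.lean` and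
`JPlanePencilCapGraph.lean`.

Wendl's universality argument (proof of Prop. 2.53, last paragraph, with Thm. 2.49): two curves of
the constrained family represent the class `ℓ`, `ℓ · ℓ = 1` in `X̂`, and a tangency at the
constraint point would force `ℓ · ℓ ≥ 2`. In the tree's plane form the count is done in `M`
(where `H₂ = 0`, `JPlanePencilMemberSphere.lean`), and the whole content of "`ℓ · ℓ = 1` with the
intersection at the constraint point" becomes the LOCAL INDEX AT `p` of the closed-up test member
`û' = (u', pencilCap p u')` against the closed-up leaf `K = u(ℂ) ∪ {p}`, computed with the
defining function `π_p = capDefFn p u r` of `JPlanePencilCapGraph.lean`. This file computes it: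

* `π_p (cap' η) = σ'(η) · g(η)` with `g = W' − Ŵ ∘ σ'` (`capDefFn_eq_mul`), and `σ' ≈ conj`
  winds `−1` (`wind_capFst_circleLoop`);
* `g` is compared with the HOLOMORPHIC germ `g₁ = W' − Ŵ₀ ∘ X'`, `Ŵ₀ = W ∘ X⁻¹` the slope of
  the leaf in the compactified coordinate `X = 1/z` (`IsPencilPlane.exists_holoSlope`):
  `|g − g₁| ≤ L |X'| (|W'| + |Ŵ₀ X'|) |g₁| = o(|g₁|)` (`norm_sub_holoGerm_le`), so both have the
  same winding numbers on small circles;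
* `g₁(0) = 0`, `g₁'(0) = b' − b`: hence (`IsPencilPlane.constraintIndex_dichotomy`) EITHER
  `g₁ ≡ 0` near `0` — the far ends of the two members coincide (`u' (ξ) ∈ u(ℂ)` for all large
  `ξ`) — OR the index `wind (π_p ∘ cap' ∘ circleLoop 0 ρ)` equals `ord₀ g₁ − 1` for all small
  `ρ`, which is `0` when the intercepts differ (`b' ≠ b`: members of different intercepts do not
  meet near `p` and contribute nothing at `p`) and `≥ 1` when they agree (`b' = b`: two distinct
  members with the same intercept are tangent at the constraint point — the configuration that
  `ℓ · ℓ = 1` forbids).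

## References

* C. Wendl, *Holomorphic Curves in Low Dimensions*, LNM 2216, Springer (2018), Prop. 2.53 (proof,
  pp. 65–66) and Thm. 2.49. [Wendl2018]
-/

noncomputable section

open scoped Manifold ContDiff Topology ComplexConjugate
open Set Function Filter Metric Complex Literature.Topology.PlaneTopology

namespace Literature.Geometry.Symplectic

/-! ### §1 Winding numbers of small circles -/

section Wind

/-- `wind (circleLoop 0 ρ ^ m) = m`. [folklore] -/
theorem wind_circleLoop_zero_pow {ρ : ℝ} (hρ : 0 < ρ) (m : ℕ) :
    wind (fun t => circleLoop 0 ρ t ^ m) = m := by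
  have h := wind_zpow (isNonvanishingLoop_circleLoop (c := 0) (R := ρ)
    (by simp [abs_of_pos hρ, hρ.ne])) (m : ℤ)
  simp only [zpow_natCast] at h
  rw [h, wind_circleLoop_zero hρ, mul_one]

/-- The circle of radius `ρ` about `0` stays in every larger ball. [folklore] -/
theorem norm_circleLoop_zero {ρ : ℝ} (hρ : 0 < ρ) (t : ℝ) : ‖circleLoop 0 ρ t‖ = ρ := by
  have := norm_circleLoop_sub_center 0 ρ t
  rwa [sub_zero, abs_of_pos hρ] at this

/-- **A germ continuous near `0` with nonzero value there is zero-free near `0` and winds `0` on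
all small circles.** [folklore] -/
theorem exists_wind_eq_zero_of_continuousOn {q : ℂ → ℂ} {δ₀ : ℝ} (hδ₀ : 0 < δ₀)
    (hq : ContinuousOn q (ball 0 δ₀)) (h0 : q 0 ≠ 0) :
    ∃ ρ₀ : ℝ, 0 < ρ₀ ∧ ρ₀ < δ₀ ∧ (∀ η : ℂ, ‖η‖ ≤ ρ₀ → ‖q η - q 0‖ < ‖q 0‖) ∧
      ∀ ρ : ℝ, 0 < ρ → ρ ≤ ρ₀ → wind (fun t => q (circleLoop 0 ρ t)) = 0 := by
  have hpos : 0 < ‖q 0‖ := norm_pos_iff.2 h0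
  have hq0 : ContinuousAt q 0 := hq.continuousAt (ball_mem_nhds 0 hδ₀)
  obtain ⟨δ, hδ, hδq⟩ := Metric.continuousAt_iff.1 hq0 (‖q 0‖) hpos
  set ρ₀ : ℝ := min δ δ₀ / 2 with hρ₀
  have hρ₀pos : 0 < ρ₀ := by positivity
  have hρ₀δ : ρ₀ < δ := by
    have : min δ δ₀ ≤ δ := min_le_left _ _
    rw [hρ₀]; linarith
  have hρ₀δ₀ : ρ₀ < δ₀ := by
    have : min δ δ₀ ≤ δ₀ := min_le_right _ _
    rw [hρ₀]; linarith
  have hnear : ∀ η : ℂ, ‖η‖ ≤ ρ₀ → ‖q η - q 0‖ < ‖q 0‖ := fun η hη => by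
    have := hδq (x := η) (by rw [dist_zero_right]; linarith)
    rwa [dist_eq_norm] at this
  refine ⟨ρ₀, hρ₀pos, hρ₀δ₀, hnear, fun ρ hρ hρρ₀ => ?_⟩
  have hc : Continuous fun t => q (circleLoop 0 ρ t) := by
    refine (hq.comp_continuous (continuous_circleLoop 0 ρ) fun t => ?_)
    rw [mem_ball_zero_iff, norm_circleLoop_zero hρ]; linarith
  have h := wind_eq_of_norm_sub_lt (f := fun t => q (circleLoop 0 ρ t)) (g := fun _ => q 0)
    hc.continuousOn (by simp [circleLoop_zero_eq]) (IsNonvanishingLoop.const h0)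
    (fun t _ => hnear _ (by rw [norm_circleLoop_zero hρ]; exact hρρ₀))
  rw [h, wind_const]

/-- Powers of the circle are zero-free loops. [folklore] -/
theorem isNonvanishingLoop_circleLoop_pow {ρ : ℝ} (hρ : 0 < ρ) (m : ℕ) :
    IsNonvanishingLoop fun t => circleLoop 0 ρ t ^ m := by
  have h := (isNonvanishingLoop_circleLoop (c := 0) (R := ρ) (by simp [abs_of_pos hρ, hρ.ne])).zpow m
  simpa using h

/-- **Winding number of an analytic germ**: if `g` is analytic at `0` and not identically zero
near `0`, there is `m : ℕ` (`= ord₀ g`; for `g 0 = 0`: `1 ≤ m`, and `m = 1` iff `g' (0) ≠ 0`)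
such that `g` is zero-free on a punctured disc and winds `m` on all small circles. [folklore] -/
theorem exists_wind_eq_order_of_analyticAt {g : ℂ → ℂ} (hg : AnalyticAt ℂ g 0)
    (hne : ¬ (∀ᶠ η in 𝓝 (0 : ℂ), g η = 0)) :
    ∃ m : ℕ, (g 0 = 0 → 1 ≤ m) ∧ (g 0 = 0 → (m = 1 ↔ deriv g 0 ≠ 0)) ∧
      ∃ ρ₀ : ℝ, 0 < ρ₀ ∧ (∀ η : ℂ, 0 < ‖η‖ → ‖η‖ ≤ ρ₀ → g η ≠ 0) ∧
        ∀ ρ : ℝ, 0 < ρ → ρ ≤ ρ₀ → wind (fun t => g (circleLoop 0 ρ t)) = m := by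
  obtain ⟨m, q, hq, hq0, hfac⟩ := (hg.exists_eventuallyEq_pow_smul_nonzero_iff).2 hne
  simp only [sub_zero, smul_eq_mul] at hfac
  obtain ⟨δ₁, hδ₁, hδ₁f⟩ := Metric.eventually_nhds_iff_ball.1 hfac
  obtain ⟨δ₂, hδ₂, hδ₂a⟩ := Metric.eventually_nhds_iff_ball.1 hq.eventually_analyticAt
  have hqc : ContinuousOn q (ball 0 (min δ₁ δ₂)) := fun η hη =>
    (hδ₂a η (ball_subset_ball (min_le_right _ _) hη)).continuousAt.continuousWithinAt
  obtain ⟨ρ₀, hρ₀, hρ₀δ, hnear, hwind⟩ :=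
    exists_wind_eq_zero_of_continuousOn (lt_min hδ₁ hδ₂) hqc hq0
  have hqne : ∀ η : ℂ, ‖η‖ ≤ ρ₀ → q η ≠ 0 := fun η hη h0 => by
    have := hnear η hη
    rw [h0, zero_sub, norm_neg] at this
    exact lt_irrefl _ this
  have hfac' : ∀ η : ℂ, ‖η‖ ≤ ρ₀ → g η = η ^ m * q η := fun η hη =>
    hδ₁f η (by rw [mem_ball_zero_iff]; exact lt_of_le_of_lt hη (lt_of_lt_of_le hρ₀δ (min_le_left _ _)))
  -- the derivative at `0` through the factorisation
  have hderiv : g 0 = 0 → (m = 1 ↔ deriv g 0 ≠ 0) := fun hg0 => by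
    have hm : m ≠ 0 := by
      rintro rfl
      exact hqne 0 (by simpa using hρ₀.le) (by simpa using (hfac' 0 (by simpa using hρ₀.le)).symm.trans hg0)
    have hqd : DifferentiableAt ℂ q 0 := hq.differentiableAt
    have hd : deriv g 0 = deriv (fun η => η ^ m * q η) 0 := Filter.EventuallyEq.deriv_eq hfac
    have hprod : HasDerivAt (fun η => η ^ m * q η)
        ((m : ℂ) * (0 : ℂ) ^ (m - 1) * q 0 + (0 : ℂ) ^ m * deriv q 0) 0 :=
      (hasDerivAt_pow m (0 : ℂ)).mul hqd.hasDerivAt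
    rw [hd, hprod.deriv, zero_pow hm, zero_mul, add_zero]
    constructor
    · rintro rfl
      simpa using hq0
    · intro h
      by_contra hm1
      have h2 : m - 1 ≠ 0 := by omega
      rw [zero_pow h2, mul_zero, zero_mul] at h
      exact h rfl
  have hone : g 0 = 0 → 1 ≤ m := fun hg0 => by
    by_contra hm
    have hm0 : m = 0 := by omega
    subst hm0
    exact hqne 0 (by simpa using hρ₀.le) (by simpa using (hfac' 0 (by simpa using hρ₀.le)).symm.trans hg0)
  refine ⟨m, hone, hderiv, ρ₀, hρ₀, fun η hη0 hη => ?_, fun ρ hρ hρρ₀ => ?_⟩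
  · rw [hfac' η hη]
    exact mul_ne_zero (pow_ne_zero _ (norm_pos_iff.1 hη0)) (hqne η hη)
  · have heq : EqOn (fun t => g (circleLoop 0 ρ t))
        (fun t => circleLoop 0 ρ t ^ m * q (circleLoop 0 ρ t)) (Icc 0 1) := fun t _ =>
      hfac' _ (by rw [norm_circleLoop_zero hρ]; exact hρρ₀)
    have hql : IsNonvanishingLoop fun t => q (circleLoop 0 ρ t) :=
      ⟨(hqc.comp_continuous (continuous_circleLoop 0 ρ) fun t => by
          rw [mem_ball_zero_iff, norm_circleLoop_zero hρ]; exact lt_of_le_of_lt hρρ₀ hρ₀δ).continuousOn,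
        fun t _ => hqne _ (by rw [norm_circleLoop_zero hρ]; exact hρρ₀),
        by simp [circleLoop_zero_eq]⟩
    rw [wind_congr heq, wind_mul (isNonvanishingLoop_circleLoop_pow hρ m) hql,
      wind_circleLoop_zero_pow hρ, hwind ρ hρ hρρ₀, add_zero]

/-- **A loop close to the identity circle winds once**: if `‖X η − η‖ < ‖η‖` on the circle of
radius `ρ` and `X` is continuous there, `wind (X ∘ circleLoop 0 ρ) = 1`. [folklore] -/
theorem wind_eq_one_of_norm_sub_self_lt {X : ℂ → ℂ} {ρ : ℝ} (hρ : 0 < ρ)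
    (hXc : Continuous fun t => X (circleLoop 0 ρ t))
    (hX : ∀ η : ℂ, ‖η‖ = ρ → ‖X η - η‖ < ‖η‖) :
    wind (fun t => X (circleLoop 0 ρ t)) = 1 := by
  rw [← wind_circleLoop_zero hρ]
  exact wind_eq_of_norm_sub_lt hXc.continuousOn (by simp [circleLoop_zero_eq])
    (isNonvanishingLoop_circleLoop (c := 0) (R := ρ) (by simp [abs_of_pos hρ, hρ.ne]))
    fun t _ => hX _ (norm_circleLoop_zero hρ t)

/-- **A positive real loop winds `0`** (restated from `wind_ofReal_eq_zero` for functions valued in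
`(0, ∞)` composed with the circle). [folklore] -/
theorem wind_ofReal_circleLoop_eq_zero {φ : ℂ → ℝ} {ρ : ℝ}
    (hφc : Continuous fun t => φ (circleLoop 0 ρ t)) (hpos : ∀ t, 0 < φ (circleLoop 0 ρ t)) :
    wind (fun t => ((φ (circleLoop 0 ρ t) : ℝ) : ℂ)) = 0 :=
  wind_ofReal_eq_zero hφc.continuousOn (fun t _ => hpos t) (by simp [circleLoop_zero_eq])

end Wind

/-! ### §2 The holomorphic slope of the leaf in the coordinate `X = 1/z` -/

section Inj

variable {M : Type*} [TopologicalSpace M] [T2Space M] [ChartedSpace (EuclideanSpace ℝ (Fin 4)) M]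

/-- `pencilCoord p` is injective on chart-source points (`flatCx ∘ ι ∘ (e − e p)` with `ι`, `flatCx`
injective and `e` injective on its source). [folklore] -/
theorem eq_of_pencilCoord_eq {p : M} {x y : punctured p}
    (hx : x.1 ∈ (chartAt (EuclideanSpace ℝ (Fin 4)) p).source)
    (hy : y.1 ∈ (chartAt (EuclideanSpace ℝ (Fin 4)) p).source)
    (hxy : pencilCoord p x = pencilCoord p y) : x = y := by
  rw [pencilCoord_eq_flatCx, pencilCoord_eq_flatCx] at hxy
  have h1 := inversion_injective (flatCx.injective hxy)
  rw [sub_left_inj] at h1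
  exact Subtype.ext ((extChartAt (𝓡 4) p).injOn (by rwa [extChartAt_source])
    (by rwa [extChartAt_source]) h1)

/-- The flat coordinates from the compactified ones: `(z, w) = (X⁻¹, W · X⁻¹)` along a cap chart
(`η ≠ 0`, `z ≠ 0`). [folklore] -/
theorem pencilCoord_eq_of_capX_capW {p : M} {u : ℂ → punctured p} {η : ℂ} (hη : η ≠ 0)
    (hz : (pencilCoord p (u η⁻¹)).1 ≠ 0) :
    pencilCoord p (u η⁻¹) = ((capX p u η)⁻¹, capW p u η * (capX p u η)⁻¹) := by
  rw [capX_of_ne_zero hη, capW_of_ne_zero hη, inv_inv, div_mul_cancel₀ _ hz]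

end Inj

namespace IsPencilPlane

variable {M : Type*} [TopologicalSpace M] [T2Space M] [CompactSpace M]
  [ChartedSpace (EuclideanSpace ℝ (Fin 4)) M] [IsManifold (𝓡 4) ∞ M]
  {p : M} {J : ∀ x : punctured p, TangentSpace (𝓡 4) x →L[ℝ] TangentSpace (𝓡 4) x}
  {u u' : ℂ → punctured p} {b b' : ℂ} {ε r : ℝ}

/-- **The compactified coordinate `X = 1/z` of a member is a local biholomorphism at `0`**
(`X(0) = 0`, `X'(0) = 1`, complex inverse function theorem): a holomorphic inverse `X⁻¹` on a
disc `ball 0 ρ`, with `X⁻¹(0) = 0`, `(X⁻¹)'(0) = 1`, values in a prescribed disc `ball 0 r₀`,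
`X (X⁻¹ a) = a`, and `X⁻¹ a ≠ 0` for `a ≠ 0`. [cite: Wendl2018, Prop. 2.53 (p. 65)] -/
theorem exists_holoInverse_capX (h : IsPencilPlane J u b) (hε : 0 < ε)
    (hJstd : ∀ x : punctured p, InPuncturedChartBall p ε x →
      ∀ (v : TangentSpace (𝓡 4) x) (c : EuclideanSpace ℝ (Fin 4)),
        inner ℝ (fderiv ℝ inversion (extChartAt (𝓡 4) p x.1 - extChartAt (𝓡 4) p p)
          (mfderiv (𝓡 4) 𝓘(ℝ, EuclideanSpace ℝ (Fin 4))
            (fun z : punctured p => extChartAt (𝓡 4) p z.1) x (J x v))) c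
        = stdSymplecticForm (fderiv ℝ inversion (extChartAt (𝓡 4) p x.1 - extChartAt (𝓡 4) p p)
          (mfderiv (𝓡 4) 𝓘(ℝ, EuclideanSpace ℝ (Fin 4))
            (fun z : punctured p => extChartAt (𝓡 4) p z.1) x v)) c)
    {r₀ : ℝ} (hr₀ : 0 < r₀) :
    ∃ ρ : ℝ, 0 < ρ ∧ ∃ Xinv : ℂ → ℂ,
      DifferentiableOn ℂ Xinv (ball 0 ρ) ∧ Xinv 0 = 0 ∧ HasDerivAt Xinv 1 0 ∧
      (∀ a ∈ ball (0 : ℂ) ρ, ‖Xinv a‖ < r₀ ∧ capX p u (Xinv a) = a) ∧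
      (∀ a ∈ ball (0 : ℂ) ρ, a ≠ 0 → Xinv a ≠ 0) := by
  haveI : SecondCountableTopology M :=
    ChartedSpace.secondCountable_of_sigmaCompact (EuclideanSpace ℝ (Fin 4)) M
  obtain ⟨r₁, hr₁, hX, -⟩ := h.exists_differentiableOn_compactification hε hJstd
  rw [← capX_eq] at hX
  have hXd : HasDerivAt (capX p u) 1 0 := by rw [capX_eq]; exact h.hasDerivAt_inv_fst_zero
  have hXa : AnalyticAt ℂ (capX p u) 0 := hX.analyticAt (ball_mem_nhds 0 hr₁)
  have hXs : HasStrictDerivAt (capX p u) 1 0 := by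
    have h1 := (hXa.contDiffAt (n := 1)).hasStrictDerivAt one_ne_zero
    rwa [hXd.deriv] at h1
  set Φ := (hXs.hasStrictFDerivAt_equiv one_ne_zero).toOpenPartialHomeomorph (capX p u) with hΦ
  have hΦf : ∀ η, Φ η = capX p u η := fun η => rfl
  have h0s : (0 : ℂ) ∈ Φ.source :=
    (hXs.hasStrictFDerivAt_equiv one_ne_zero).mem_toOpenPartialHomeomorph_source
  have h0t : (0 : ℂ) ∈ Φ.target := by
    have := (hXs.hasStrictFDerivAt_equiv one_ne_zero).image_mem_toOpenPartialHomeomorph_target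
    rwa [capX_zero] at this
  have hsymm0 : Φ.symm 0 = 0 := by
    have := Φ.left_inv h0s
    rwa [hΦf, capX_zero] at this
  have hct : ContinuousAt Φ.symm 0 := Φ.continuousAt_symm h0t
  have hderivc : ContinuousAt (deriv (capX p u)) 0 := hXa.deriv.continuousAt
  have hG : {η : ℂ | deriv (capX p u) η ≠ 0} ∈ 𝓝 (0 : ℂ) :=
    hderivc.preimage_mem_nhds (isOpen_ne.mem_nhds (by rw [hXd.deriv]; exact one_ne_zero))
  have hpre : Φ.symm ⁻¹' ({η : ℂ | deriv (capX p u) η ≠ 0} ∩ ball 0 (min r₀ r₁)) ∈ 𝓝 (0 : ℂ) :=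
    hct.preimage_mem_nhds (by
      rw [hsymm0]; exact inter_mem hG (ball_mem_nhds 0 (lt_min hr₀ hr₁)))
  obtain ⟨ρ, hρ, hρsub⟩ := Metric.mem_nhds_iff.1 (inter_mem hpre (Φ.open_target.mem_nhds h0t))
  refine ⟨ρ, hρ, Φ.symm, ?_, hsymm0, ?_, ?_, ?_⟩
  · intro a ha
    obtain ⟨⟨hda, hba⟩, hta⟩ := hρsub ha
    have hdiff : DifferentiableAt ℂ (capX p u) (Φ.symm a) :=
      hX.differentiableAt (isOpen_ball.mem_nhds (ball_subset_ball (min_le_right _ _) hba))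
    exact (Φ.hasDerivAt_symm hta hda hdiff.hasDerivAt).differentiableAt.differentiableWithinAt
  · have h1 := Φ.hasDerivAt_symm h0t one_ne_zero (by rw [hsymm0]; exact hXd)
    simpa using h1
  · intro a ha
    obtain ⟨⟨-, hba⟩, hta⟩ := hρsub ha
    refine ⟨lt_of_lt_of_le (mem_ball_zero_iff.1 hba) (min_le_left _ _), ?_⟩
    have := Φ.right_inv hta
    rwa [hΦf] at this
  · intro a ha ha0 h0
    obtain ⟨-, hta⟩ := hρsub ha
    have := Φ.right_inv hta
    rw [h0, hΦf, capX_zero] at this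
    exact ha0 this.symm

omit [CompactSpace M] [IsManifold (𝓡 4) ∞ M] in
/-- **`π_p` along the cap of another member**: `π_p (cap' η) = σ'(η) · (W'(η) − Ŵ(σ'(η)))` on the
cap disc of `u'` (`capDefFn_eq_mul` at `u' (η⁻¹)`). [cite: Wendl2018, Prop. 2.53 with Thm. 2.49] -/
theorem capDefFn_pencilCap_eq {r' : ℝ}
    (hdisc' : ∀ η : ℂ, η ≠ 0 → ‖η‖ < r' →
      InPuncturedChartBall p ε (u' η⁻¹) ∧ 1 < ‖(pencilCoord p (u' η⁻¹)).1‖)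
    {η : ℂ} (hη : η ∈ ball (0 : ℂ) r') :
    capDefFn p u r (pencilCap p u' η) =
      capFst p u' η * (capW p u' η - capSlope p u r (capFst p u' η)) := by
  rcases eq_or_ne η 0 with rfl | hη0
  · simp [capDefFn, capSlope]
  · have hz : (pencilCoord p (u' η⁻¹)).1 ≠ 0 :=
      norm_pos_iff.1 (lt_trans one_pos (hdisc' η hη0 (mem_ball_zero_iff.1 hη)).2)
    have hpair := (flatPair_pencilCap hdisc' hη).2
    rw [pencilCap_of_ne_zero hη0] at hpair ⊢
    rw [capDefFn_eq_mul (u' η⁻¹) hz, hpair, ← capW_of_ne_zero hη0]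

/-- **The first flat coordinate along a cap winds `−1`**: `σ' = (1 + |W'|²)⁻¹ · conj X'` with
`X'(η) = η + o(η)`; on all small circles `σ'` is zero-free and `wind (σ' ∘ circleLoop 0 ρ) = −1`.
[cite: Wendl2018, Prop. 2.53 (p. 65)] -/
theorem wind_capFst_circleLoop (h' : IsPencilPlane J u' b') (hε : 0 < ε)
    (hJstd : ∀ x : punctured p, InPuncturedChartBall p ε x →
      ∀ (v : TangentSpace (𝓡 4) x) (c : EuclideanSpace ℝ (Fin 4)),
        inner ℝ (fderiv ℝ inversion (extChartAt (𝓡 4) p x.1 - extChartAt (𝓡 4) p p)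
          (mfderiv (𝓡 4) 𝓘(ℝ, EuclideanSpace ℝ (Fin 4))
            (fun z : punctured p => extChartAt (𝓡 4) p z.1) x (J x v))) c
        = stdSymplecticForm (fderiv ℝ inversion (extChartAt (𝓡 4) p x.1 - extChartAt (𝓡 4) p p)
          (mfderiv (𝓡 4) 𝓘(ℝ, EuclideanSpace ℝ (Fin 4))
            (fun z : punctured p => extChartAt (𝓡 4) p z.1) x v)) c) :
    ∃ ρ₀ : ℝ, 0 < ρ₀ ∧ (∀ η : ℂ, 0 < ‖η‖ → ‖η‖ ≤ ρ₀ → capFst p u' η ≠ 0) ∧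
      ContinuousOn (capFst p u') (closedBall 0 ρ₀) ∧
      ∀ ρ : ℝ, 0 < ρ → ρ ≤ ρ₀ → wind (fun t => capFst p u' (circleLoop 0 ρ t)) = -1 := by
  haveI : SecondCountableTopology M :=
    ChartedSpace.secondCountable_of_sigmaCompact (EuclideanSpace ℝ (Fin 4)) M
  obtain ⟨r₂, hr₂, hσ', hW', hX'⟩ := h'.contDiffOn_capFst hε hJstd
  have hXd : HasDerivAt (capX p u') 1 0 := by rw [capX_eq]; exact h'.hasDerivAt_inv_fst_zero
  -- `‖X' η − η‖ ≤ ‖η‖ / 2` near `0`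
  have hlo := hXd.isLittleO
  simp only [sub_zero, capX_zero, smul_eq_mul, mul_one] at hlo
  obtain ⟨δ, hδ, hδo⟩ := Metric.eventually_nhds_iff_ball.1 (hlo.def (by norm_num : (0 : ℝ) < 1 / 2))
  set ρ₀ : ℝ := min δ r₂ / 2 with hρ₀_def
  have hρ₀ : 0 < ρ₀ := by positivity
  have hρ₀δ : ρ₀ < δ := by
    have : min δ r₂ ≤ δ := min_le_left _ _
    rw [hρ₀_def]; linarith
  have hρ₀r : ρ₀ < r₂ := by
    have : min δ r₂ ≤ r₂ := min_le_right _ _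
    rw [hρ₀_def]; linarith
  have hXsub : ∀ η : ℂ, ‖η‖ ≤ ρ₀ → ‖capX p u' η - η‖ ≤ 1 / 2 * ‖η‖ := fun η hη =>
    hδo η (by rw [mem_ball_zero_iff]; linarith)
  have hXne : ∀ η : ℂ, 0 < ‖η‖ → ‖η‖ ≤ ρ₀ → capX p u' η ≠ 0 := fun η hη0 hη h0 => by
    have := hXsub η hη
    rw [h0, zero_sub, norm_neg] at this
    linarith
  have hφpos : ∀ η : ℂ, 0 < (1 + ‖capW p u' η‖ ^ 2)⁻¹ := fun η => by positivity
  refine ⟨ρ₀, hρ₀, fun η hη0 hη => ?_, ?_, fun ρ hρ hρρ₀ => ?_⟩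
  · rw [capFst_eq]
    exact smul_ne_zero (hφpos η).ne' ((map_ne_zero _).2 (hXne η hη0 hη))
  · exact hσ'.continuousOn.mono (closedBall_subset_ball hρ₀r)
  · -- the three loops
    have hcirc : ∀ t, ‖circleLoop 0 ρ t‖ ≤ ρ₀ := fun t => by rw [norm_circleLoop_zero hρ]; exact hρρ₀
    have hcircr : ∀ t, circleLoop 0 ρ t ∈ ball (0 : ℂ) r₂ := fun t => by
      rw [mem_ball_zero_iff, norm_circleLoop_zero hρ]; linarith
    have hXc : Continuous fun t => capX p u' (circleLoop 0 ρ t) :=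
      hX'.continuousOn.comp_continuous (continuous_circleLoop 0 ρ) hcircr
    have hWc : Continuous fun t => capW p u' (circleLoop 0 ρ t) :=
      hW'.continuousOn.comp_continuous (continuous_circleLoop 0 ρ) hcircr
    have hwX : wind (fun t => capX p u' (circleLoop 0 ρ t)) = 1 :=
      wind_eq_one_of_norm_sub_self_lt hρ hXc fun η hη => by
        have h1 := hXsub η (by rw [hη]; exact hρρ₀)
        have h2 : 0 < ‖η‖ := by rw [hη]; exact hρ
        linarith
    have hXl : IsNonvanishingLoop fun t => capX p u' (circleLoop 0 ρ t) :=
      ⟨hXc.continuousOn, fun t _ => hXne _ (by rw [norm_circleLoop_zero hρ]; exact hρ) (hcirc t),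
        by simp [circleLoop_zero_eq]⟩
    have hconjl : IsNonvanishingLoop fun t => conj (capX p u' (circleLoop 0 ρ t)) :=
      ⟨Complex.continuous_conj.comp_continuousOn hXl.continuousOn,
        fun t ht => (map_ne_zero _).2 (hXl.ne_zero t ht), by simp [circleLoop_zero_eq]⟩
    have hφc : Continuous fun t => (1 + ‖capW p u' (circleLoop 0 ρ t)‖ ^ 2)⁻¹ :=
      Continuous.inv₀ (continuous_const.add (hWc.norm.pow 2)) fun t => by positivity
    have hφl : IsNonvanishingLoop fun t => (((1 + ‖capW p u' (circleLoop 0 ρ t)‖ ^ 2)⁻¹ : ℝ) : ℂ) :=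
      ⟨(Complex.continuous_ofReal.comp hφc).continuousOn,
        fun t _ => by exact_mod_cast (hφpos _).ne', by simp [circleLoop_zero_eq]⟩
    have hwφ : wind (fun t => (((1 + ‖capW p u' (circleLoop 0 ρ t)‖ ^ 2)⁻¹ : ℝ) : ℂ)) = 0 :=
      wind_ofReal_circleLoop_eq_zero (φ := fun η => (1 + ‖capW p u' η‖ ^ 2)⁻¹) hφc fun t => hφpos _
    have heq : EqOn (fun t => capFst p u' (circleLoop 0 ρ t))
        (fun t => (((1 + ‖capW p u' (circleLoop 0 ρ t)‖ ^ 2)⁻¹ : ℝ) : ℂ) *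
          conj (capX p u' (circleLoop 0 ρ t))) (Icc 0 1) := fun t _ => by
      simp only
      rw [capFst_eq, Complex.real_smul]
    rw [wind_congr heq, wind_mul hφl hconjl, hwφ, wind_conj hXl, hwX, zero_add]

/-- An elementary inequality: `|(1 + s²)⁻¹ − (1 + t²)⁻¹| ≤ |t − s| (t + s)` for `s, t ≥ 0`.
[folklore] -/
theorem abs_inv_one_add_sq_sub_le {s t : ℝ} (hs : 0 ≤ s) (ht : 0 ≤ t) :
    |(1 + s ^ 2)⁻¹ - (1 + t ^ 2)⁻¹| ≤ |t - s| * (t + s) := by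
  have h1 : 0 < 1 + s ^ 2 := by positivity
  have h2 : 0 < 1 + t ^ 2 := by positivity
  have heq : (1 + s ^ 2)⁻¹ - (1 + t ^ 2)⁻¹ = (t - s) * (t + s) / ((1 + s ^ 2) * (1 + t ^ 2)) := by
    field_simp; ring
  rw [heq, abs_div, abs_mul, abs_of_nonneg (by positivity : 0 ≤ t + s),
    abs_of_pos (by positivity : 0 < (1 + s ^ 2) * (1 + t ^ 2))]
  refine div_le_self (by positivity) ?_
  nlinarith [sq_nonneg s, sq_nonneg t, sq_nonneg (s * t)]

/-- **The local index of two members at the constraint point: dichotomy.** Let `u` (intercept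
`b`) and `u'` (intercept `b'`) be pencil members, and `π_p = capDefFn p u r` the defining function
of the closed-up leaf `u(ℂ) ∪ {p}` near `p` on a good disc of radius `r`
(`IsPencilPlane.exists_capDefFn`). Then EITHER the far ends coincide — `u' (η⁻¹) ∈ u(ℂ)` for
all small `η ≠ 0` — OR there is `m ≥ 1`, with `m = 1` iff `b' ≠ b`, such that `p` is an isolated
point of `û'⁻¹(K)` and for all small `ρ > 0`
`wind (π_p ∘ pencilCap p u' ∘ circleLoop 0 ρ) = m − 1`:
`0` for different intercepts, `≥ 1` for equal intercepts (tangency at the constraint point).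
[cite: Wendl2018, Prop. 2.53 (proof, pp. 65–66) with Thm. 2.49] -/
theorem constraintIndex_dichotomy (h : IsPencilPlane J u b) (h' : IsPencilPlane J u' b')
    (hε : 0 < ε)
    (hJstd : ∀ x : punctured p, InPuncturedChartBall p ε x →
      ∀ (v : TangentSpace (𝓡 4) x) (c : EuclideanSpace ℝ (Fin 4)),
        inner ℝ (fderiv ℝ inversion (extChartAt (𝓡 4) p x.1 - extChartAt (𝓡 4) p p)
          (mfderiv (𝓡 4) 𝓘(ℝ, EuclideanSpace ℝ (Fin 4))
            (fun z : punctured p => extChartAt (𝓡 4) p z.1) x (J x v))) c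
        = stdSymplecticForm (fderiv ℝ inversion (extChartAt (𝓡 4) p x.1 - extChartAt (𝓡 4) p p)
          (mfderiv (𝓡 4) 𝓘(ℝ, EuclideanSpace ℝ (Fin 4))
            (fun z : punctured p => extChartAt (𝓡 4) p z.1) x v)) c)
    (hr : 0 < r)
    (hdisc : ∀ η : ℂ, η ≠ 0 → ‖η‖ < r →
      InPuncturedChartBall p ε (u η⁻¹) ∧ 1 < ‖(pencilCoord p (u η⁻¹)).1‖)
    (hσ : ContDiffOn ℝ ∞ (capFst p u) (ball 0 r)) (hWr : ContDiffOn ℝ ∞ (capW p u) (ball 0 r))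
    (hinj : InjOn (capFst p u) (ball 0 r))
    (hbij : ∀ η ∈ ball (0 : ℂ) r, Bijective (fderiv ℝ (capFst p u) η)) :
    (∀ᶠ η in 𝓝 (0 : ℂ), η ≠ 0 → u' η⁻¹ ∈ range u) ∨
    ∃ m : ℕ, 1 ≤ m ∧ (m = 1 ↔ b' ≠ b) ∧ ∃ ρ₀ : ℝ, 0 < ρ₀ ∧
      (∀ η : ℂ, 0 < ‖η‖ → ‖η‖ ≤ ρ₀ → capDefFn p u r (pencilCap p u' η) ≠ 0) ∧
      ∀ ρ : ℝ, 0 < ρ → ρ ≤ ρ₀ →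
        wind (fun t => capDefFn p u r (pencilCap p u' (circleLoop 0 ρ t))) = (m : ℤ) - 1 := by
  haveI : SecondCountableTopology M :=
    ChartedSpace.secondCountable_of_sigmaCompact (EuclideanSpace ℝ (Fin 4)) M
  /- (1) holomorphic cap data of the leaf `u` -/
  obtain ⟨rK, hrK, hXK, hWK⟩ := h.exists_differentiableOn_compactification hε hJstd
  rw [← capX_eq] at hXK
  rw [← capW_eq] at hWK
  have hWKd : HasDerivAt (capW p u) b 0 := by rw [capW_eq]; exact h.hasDerivAt_snd_div_fst_zero
  /- (2) the holomorphic inverse of `X_K`, with values in `ball 0 (min r rK)` -/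
  obtain ⟨ρX, hρX, Xinv, hXiD, hXi0, hXid, hXiP, hXine⟩ :=
    h.exists_holoInverse_capX hε hJstd (lt_min hr hrK)
  /- (3) cap data of the test member `u'` -/
  obtain ⟨r', hr', hdisc'⟩ := h'.exists_cap_radius hε
  obtain ⟨r₂, hr₂, hσ'c, hW'c, hX'c⟩ := h'.contDiffOn_capFst hε hJstd
  obtain ⟨r₁, hr₁, hX'C, hW'C⟩ := h'.exists_differentiableOn_compactification hε hJstd
  rw [← capX_eq] at hX'C
  rw [← capW_eq] at hW'C
  have hX'd : HasDerivAt (capX p u') 1 0 := by rw [capX_eq]; exact h'.hasDerivAt_inv_fst_zero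
  have hW'd : HasDerivAt (capW p u') b' 0 := by rw [capW_eq]; exact h'.hasDerivAt_snd_div_fst_zero
  /- (4) a disc on which `X'` lands in the domain of `X_K⁻¹` -/
  have hX'ct : ContinuousAt (capX p u') 0 := (hX'C.continuousOn.continuousAt (ball_mem_nhds 0 hr₁))
  obtain ⟨δ₁, hδ₁, hδ₁P⟩ : ∃ δ > 0, δ ≤ r₁ ∧ ∀ η ∈ ball (0 : ℂ) δ, capX p u' η ∈ ball (0 : ℂ) ρX := by
    have hpre : capX p u' ⁻¹' ball 0 ρX ∈ 𝓝 (0 : ℂ) :=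
      hX'ct.preimage_mem_nhds (by rw [capX_zero]; exact ball_mem_nhds 0 hρX)
    obtain ⟨δ, hδ, hδs⟩ := Metric.mem_nhds_iff.1 hpre
    exact ⟨min δ r₁, lt_min hδ hr₁, min_le_right _ _,
      fun η hη => hδs (ball_subset_ball (min_le_left _ _) hη)⟩
  /- (5) the holomorphic germ `g₁ = W' − W_K ∘ X_K⁻¹ ∘ X'` -/
  set g₁ : ℂ → ℂ := fun η => capW p u' η - capW p u (Xinv (capX p u' η)) with hg₁_def
  have hmaps1 : MapsTo (capX p u') (ball 0 δ₁) (ball 0 ρX) := fun η hη => hδ₁P.2 η hη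
  have hmaps2 : MapsTo Xinv (ball 0 ρX) (ball 0 rK) := fun a ha =>
    mem_ball_zero_iff.2 (lt_of_lt_of_le (hXiP a ha).1 (min_le_right _ _))
  have hg₁D : DifferentiableOn ℂ g₁ (ball 0 δ₁) :=
    (hW'C.mono (ball_subset_ball hδ₁P.1)).sub
      ((hWK.comp hXiD hmaps2).comp (hX'C.mono (ball_subset_ball hδ₁P.1)) hmaps1)
  have hg₁a : AnalyticAt ℂ g₁ 0 := hg₁D.analyticAt (ball_mem_nhds 0 hδ₁)
  have hg₁0 : g₁ 0 = 0 := by simp [hg₁_def, hXi0]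
  have hg₁d : HasDerivAt g₁ (b' - b) 0 := by
    have h1 : HasDerivAt Xinv 1 (capX p u' 0) := by rw [capX_zero]; exact hXid
    have h2 : HasDerivAt (fun η => Xinv (capX p u' η)) (1 * 1) 0 := h1.comp 0 hX'd
    have h3 : HasDerivAt (capW p u) b ((fun η => Xinv (capX p u' η)) 0) := by
      simp only [capX_zero, hXi0]; exact hWKd
    have h4 : HasDerivAt (capW p u ∘ fun η => Xinv (capX p u' η)) (b * (1 * 1)) 0 := h3.comp 0 h2
    have h5 : HasDerivAt (fun η => capW p u' η - capW p u (Xinv (capX p u' η))) (b' - b * (1 * 1)) 0 :=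
      hW'd.sub h4
    exact h5.congr_deriv (by ring)
  /- (6) the dichotomy -/
  by_cases hzero : ∀ᶠ η in 𝓝 (0 : ℂ), g₁ η = 0
  · /- Case A: the far ends coincide -/
    left
    filter_upwards [hzero, ball_mem_nhds (0 : ℂ) (lt_min hδ₁ hr')] with η hgη hη hη0
    have hηδ : η ∈ ball (0 : ℂ) δ₁ := ball_subset_ball (min_le_left _ _) hη
    have hηr' : ‖η‖ < r' := lt_of_lt_of_le (mem_ball_zero_iff.1 hη) (min_le_right _ _)
    have hz' : (pencilCoord p (u' η⁻¹)).1 ≠ 0 :=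
      norm_pos_iff.1 (lt_trans one_pos (hdisc' η hη0 hηr').2)
    set a : ℂ := capX p u' η with ha_def
    have ha : a ∈ ball (0 : ℂ) ρX := hδ₁P.2 η hηδ
    have ha0 : a ≠ 0 := by rw [ha_def, capX_of_ne_zero hη0]; exact inv_ne_zero hz'
    set η₁ : ℂ := Xinv a with hη₁_def
    have hη₁0 : η₁ ≠ 0 := hXine a ha ha0
    have hη₁r : ‖η₁‖ < r := lt_of_lt_of_le (hXiP a ha).1 (min_le_left _ _)
    have hXη₁ : capX p u η₁ = a := (hXiP a ha).2
    have hWη₁ : capW p u' η = capW p u η₁ := sub_eq_zero.1 hgη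
    have hz₁ : (pencilCoord p (u η₁⁻¹)).1 ≠ 0 :=
      norm_pos_iff.1 (lt_trans one_pos (hdisc η₁ hη₁0 hη₁r).2)
    have hpc : pencilCoord p (u' η⁻¹) = pencilCoord p (u η₁⁻¹) := by
      rw [pencilCoord_eq_of_capX_capW hη0 hz', pencilCoord_eq_of_capX_capW hη₁0 hz₁, hXη₁, hWη₁]
    exact ⟨η₁⁻¹, (eq_of_pencilCoord_eq (hdisc' η hη0 hηr').1.1 (hdisc η₁ hη₁0 hη₁r).1.1 hpc).symm⟩
  · /- Case B: a finite order of contact -/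
    right
    obtain ⟨m, hone, hderiv, ρg, hρg, hg₁ne, hg₁wind⟩ := exists_wind_eq_order_of_analyticAt hg₁a hzero
    refine ⟨m, hone hg₁0, ?_, ?_⟩
    · rw [hderiv hg₁0, hg₁d.deriv, sub_ne_zero]
    /- (B1) Lipschitz constants for `W_K` and `σ_K⁻¹` near `0` -/
    have hWK1 : ContDiffAt ℝ 1 (capW p u) 0 :=
      (hWr.contDiffAt (ball_mem_nhds 0 hr)).of_le (by exact_mod_cast le_top)
    obtain ⟨L₁, N₁, hN₁, hlip₁⟩ := hWK1.exists_lipschitzOnWith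
    set σinv : ℂ → ℂ := invFunOn (capFst p u) (ball 0 r) with hσinv_def
    have hopen : IsOpen (capFst p u '' ball 0 r) := isOpen_image_capFst hσ hbij
    have h0im : (0 : ℂ) ∈ capFst p u '' ball 0 r := ⟨0, mem_ball_self hr, capFst_zero⟩
    have hσinvC : ContDiffOn ℝ ∞ σinv (capFst p u '' ball 0 r) := by
      have hinv := Literature.Geometry.Manifold.contMDiffOn_invFunOn_of_bijective_mfderiv
        (I := 𝓘(ℝ, ℂ)) (J := 𝓘(ℝ, ℂ)) isOpen_ball hσ.contMDiffOn hinj fun η hη => by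
          rw [mfderiv_eq_fderiv]; exact hbij η hη
      exact contMDiffOn_iff_contDiffOn.1 hinv
    have hσinv1 : ContDiffAt ℝ 1 σinv 0 :=
      (hσinvC.contDiffAt (hopen.mem_nhds h0im)).of_le (by exact_mod_cast le_top)
    obtain ⟨L₂, N₂, hN₂, hlip₂⟩ := hσinv1.exists_lipschitzOnWith
    have hσinv_apply : ∀ η ∈ ball (0 : ℂ) r, σinv (capFst p u η) = η := fun η hη =>
      Literature.Geometry.Manifold.invFunOn_apply hinj hη
    have hσinv0 : σinv 0 = 0 := by
      have := hσinv_apply 0 (mem_ball_self hr)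
      rwa [capFst_zero] at this
    have hslopeC : ContinuousOn (capSlope p u r) (capFst p u '' ball 0 r) :=
      (contDiffOn_capSlope hσ hWr hinj hbij).continuousOn
    /- (B2) continuity at `0` of the auxiliary maps -/
    have hσ'ct : ContinuousAt (capFst p u') 0 := hσ'c.continuousOn.continuousAt (ball_mem_nhds 0 hr₂)
    have hW'ct : ContinuousAt (capW p u') 0 := hW'c.continuousOn.continuousAt (ball_mem_nhds 0 hr₂)
    have hη₁ct : ContinuousAt (fun η => Xinv (capX p u' η)) 0 := by
      have : ContinuousAt Xinv (capX p u' 0) := by rw [capX_zero]; exact hXid.continuousAt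
      exact this.comp hX'ct
    have hWKct : ContinuousAt (capW p u) 0 := hWKd.continuousAt
    have hσKct : ContinuousAt (capFst p u) 0 := hσ.continuousOn.continuousAt (ball_mem_nhds 0 hr)
    have hσinvct : ContinuousAt σinv 0 := hσinvC.continuousOn.continuousAt (hopen.mem_nhds h0im)
    have hval : (fun η => Xinv (capX p u' η)) 0 = 0 := by simp [hXi0]
    have hA : ContinuousAt (fun η => capW p u (Xinv (capX p u' η))) 0 :=
      hWKct.comp_of_eq hη₁ct hval
    have hB : ContinuousAt (fun η => capFst p u (Xinv (capX p u' η))) 0 :=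
      hσKct.comp_of_eq hη₁ct hval
    have hCσ : ContinuousAt (fun η => σinv (capFst p u' η)) 0 := by
      have : ContinuousAt σinv (capFst p u' 0) := by rw [capFst_zero]; exact hσinvct
      exact this.comp hσ'ct
    set Q : ℂ → ℝ := fun η => (L₁ : ℝ) * L₂ * ‖capX p u' η‖ *
      (‖capW p u' η‖ + ‖capW p u (Xinv (capX p u' η))‖) with hQ_def
    have hQ : ContinuousAt Q 0 :=
      (continuousAt_const.mul hX'ct.norm).mul (hW'ct.norm.add hA.norm)
    have hQ0 : Q 0 < 1 / 2 := by simp [hQ_def]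
    obtain ⟨ρσ, hρσ, hσ'ne, hσ'cont, hσ'wind⟩ := h'.wind_capFst_circleLoop hε hJstd
    /- (B3) the neighbourhood of `0` where all estimates hold -/
    set T : Set ℂ :=
      (capFst p u' ⁻¹' (capFst p u '' ball 0 r) ∩ capFst p u' ⁻¹' N₂) ∩
      ((fun η => Xinv (capX p u' η)) ⁻¹' N₁ ∩ (fun η => capFst p u (Xinv (capX p u' η))) ⁻¹' N₂) ∩
      ((fun η => σinv (capFst p u' η)) ⁻¹' N₁ ∩ Q ⁻¹' Iio (1 / 2)) ∩
      (ball 0 δ₁ ∩ ball 0 r' ∩ ball 0 r₂ ∩ closedBall 0 ρg ∩ closedBall 0 ρσ) with hT_def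
    have hT : T ∈ 𝓝 (0 : ℂ) := by
      refine inter_mem (inter_mem (inter_mem (inter_mem ?_ ?_) (inter_mem ?_ ?_)) (inter_mem ?_ ?_)) ?_
      · exact hσ'ct.preimage_mem_nhds (by rw [capFst_zero]; exact hopen.mem_nhds h0im)
      · exact hσ'ct.preimage_mem_nhds (by rw [capFst_zero]; exact hN₂)
      · exact hη₁ct.preimage_mem_nhds (by simp only [capX_zero, hXi0]; exact hN₁)
      · exact hB.preimage_mem_nhds (by simp only [capX_zero, hXi0, capFst_zero]; exact hN₂)
      · exact hCσ.preimage_mem_nhds (by simp only [capFst_zero, hσinv0]; exact hN₁)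
      · exact hQ.preimage_mem_nhds (Iio_mem_nhds hQ0)
      · exact inter_mem (inter_mem (inter_mem (inter_mem (ball_mem_nhds 0 hδ₁) (ball_mem_nhds 0 hr'))
          (ball_mem_nhds 0 hr₂)) (closedBall_mem_nhds 0 hρg)) (closedBall_mem_nhds 0 hρσ)
    obtain ⟨ρ₁, hρ₁, hρ₁T⟩ := Metric.mem_nhds_iff.1 hT
    set ρ₀ : ℝ := ρ₁ / 2 with hρ₀_def
    have hρ₀ : 0 < ρ₀ := by positivity
    have hmemT : ∀ η : ℂ, ‖η‖ ≤ ρ₀ → η ∈ T := fun η hη =>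
      hρ₁T (mem_ball_zero_iff.2 (by rw [hρ₀_def] at hη; linarith))
    have hTmem : ∀ η : ℂ, ‖η‖ ≤ ρ₀ →
        (capFst p u' η ∈ capFst p u '' ball 0 r ∧ capFst p u' η ∈ N₂) ∧
        (Xinv (capX p u' η) ∈ N₁ ∧ capFst p u (Xinv (capX p u' η)) ∈ N₂) ∧
        (σinv (capFst p u' η) ∈ N₁ ∧ Q η < 1 / 2) ∧
        (‖η‖ < δ₁ ∧ ‖η‖ < r' ∧ ‖η‖ < r₂ ∧ ‖η‖ ≤ ρg ∧ ‖η‖ ≤ ρσ) := by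
      intro η hη
      have hm := hmemT η hη
      simp only [hT_def, mem_inter_iff, mem_preimage, mem_Iio, mem_ball_zero_iff,
        mem_closedBall_zero_iff] at hm
      obtain ⟨⟨⟨⟨h1, h2⟩, h3, h4⟩, h5, h6⟩, ⟨⟨⟨h7, h8⟩, h9⟩, h10⟩, h11⟩ := hm
      exact ⟨⟨h1, h2⟩, ⟨h3, h4⟩, ⟨h5, h6⟩, h7, h8, h9, h10, h11⟩
    have hρ₀σ : ρ₀ ≤ ρσ := by
      have := (hTmem (ρ₀ : ℂ) (by rw [Complex.norm_real, Real.norm_eq_abs, abs_of_pos hρ₀])).2.2.2.2.2.2.2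
      rwa [Complex.norm_real, Real.norm_eq_abs, abs_of_pos hρ₀] at this
    have hρ₀g : ρ₀ ≤ ρg := by
      have := (hTmem (ρ₀ : ℂ) (by rw [Complex.norm_real, Real.norm_eq_abs, abs_of_pos hρ₀])).2.2.2.2.2.2.1
      rwa [Complex.norm_real, Real.norm_eq_abs, abs_of_pos hρ₀] at this
    /- (B4) the pointwise comparison `‖g − g₁‖ ≤ ‖g₁‖ / 2` -/
    have hest : ∀ η : ℂ, ‖η‖ ≤ ρ₀ →
        ‖(capW p u' η - capSlope p u r (capFst p u' η)) - g₁ η‖ ≤ 1 / 2 * ‖g₁ η‖ := by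
      intro η hη
      obtain ⟨⟨hT1, hT2⟩, ⟨hT3, hT4⟩, ⟨hT5, hT6⟩, hTδ, hTr', hTr₂, hTg, hTσ⟩ := hTmem η hη
      set a : ℂ := capX p u' η with ha_def
      set η₁ : ℂ := Xinv a with hη₁_def
      set η₂ : ℂ := σinv (capFst p u' η) with hη₂_def
      have ha : a ∈ ball (0 : ℂ) ρX := hδ₁P.2 η (mem_ball_zero_iff.2 hTδ)
      have hη₁r : η₁ ∈ ball (0 : ℂ) r :=
        mem_ball_zero_iff.2 (lt_of_lt_of_le (hXiP a ha).1 (min_le_left _ _))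
      have hXη₁ : capX p u η₁ = a := (hXiP a ha).2
      have hdiff : (capW p u' η - capSlope p u r (capFst p u' η)) - g₁ η =
          capW p u η₁ - capW p u η₂ := by
        simp only [hg₁_def, capSlope, hη₂_def, hσinv_def, hη₁_def, ha_def]; ring
      -- Lipschitz steps
      have e1 : ‖capW p u η₁ - capW p u η₂‖ ≤ L₁ * ‖η₁ - η₂‖ := by
        have := hlip₁.dist_le_mul η₁ hT3 η₂ hT5
        rwa [dist_eq_norm, dist_eq_norm] at this
      have e2 : ‖η₁ - η₂‖ ≤ L₂ * ‖capFst p u η₁ - capFst p u' η‖ := by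
        have := hlip₂.dist_le_mul _ hT4 _ hT2
        rwa [dist_eq_norm, dist_eq_norm, hσinv_apply η₁ hη₁r] at this
      -- the difference of the two first coordinates
      set sK : ℝ := ‖capW p u η₁‖ with hsK
      set t' : ℝ := ‖capW p u' η‖ with ht'
      have e3 : ‖capFst p u η₁ - capFst p u' η‖ ≤ ‖g₁ η‖ * (t' + sK) * ‖a‖ := by
        have hrepr : capFst p u η₁ - capFst p u' η =
            (((1 + sK ^ 2)⁻¹ - (1 + t' ^ 2)⁻¹ : ℝ)) • conj a := by
          rw [capFst_eq, capFst_eq, hXη₁, ← sub_smul]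
        rw [hrepr, norm_smul, Real.norm_eq_abs, Complex.norm_conj]
        have h1 := abs_inv_one_add_sq_sub_le (s := sK) (t := t') (norm_nonneg _) (norm_nonneg _)
        have h2 : |t' - sK| ≤ ‖g₁ η‖ := by
          rw [ht', hsK]
          have := abs_norm_sub_norm_le (capW p u' η) (capW p u η₁)
          simpa [hg₁_def, hη₁_def, ha_def] using this
        have h3 : |(1 + sK ^ 2)⁻¹ - (1 + t' ^ 2)⁻¹| ≤ ‖g₁ η‖ * (t' + sK) :=
          le_trans h1 (mul_le_mul_of_nonneg_right h2 (by positivity))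
        exact mul_le_mul_of_nonneg_right h3 (norm_nonneg _)
      have hQη : (L₁ : ℝ) * L₂ * ‖a‖ * (t' + sK) < 1 / 2 := by
        simpa [hQ_def, ha_def, ht', hsK, hη₁_def] using hT6
      calc ‖(capW p u' η - capSlope p u r (capFst p u' η)) - g₁ η‖
          = ‖capW p u η₁ - capW p u η₂‖ := by rw [hdiff]
        _ ≤ L₁ * (L₂ * (‖g₁ η‖ * (t' + sK) * ‖a‖)) := by
          refine le_trans e1 (mul_le_mul_of_nonneg_left (le_trans e2 ?_) (NNReal.coe_nonneg _))
          exact mul_le_mul_of_nonneg_left e3 (NNReal.coe_nonneg _)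
        _ = ((L₁ : ℝ) * L₂ * ‖a‖ * (t' + sK)) * ‖g₁ η‖ := by ring
        _ ≤ 1 / 2 * ‖g₁ η‖ := mul_le_mul_of_nonneg_right hQη.le (norm_nonneg _)
    /- (B5) conclusion -/
    have hfac : ∀ η : ℂ, ‖η‖ ≤ ρ₀ → capDefFn p u r (pencilCap p u' η) =
        capFst p u' η * (capW p u' η - capSlope p u r (capFst p u' η)) := fun η hη =>
      capDefFn_pencilCap_eq hdisc' (mem_ball_zero_iff.2 (hTmem η hη).2.2.2.2.1)
    have hgne : ∀ η : ℂ, 0 < ‖η‖ → ‖η‖ ≤ ρ₀ →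
        capW p u' η - capSlope p u r (capFst p u' η) ≠ 0 := fun η hη0 hη h0 => by
      have h1 := hest η hη
      rw [h0, zero_sub, norm_neg] at h1
      have h2 : g₁ η ≠ 0 := hg₁ne η hη0 (hTmem η hη).2.2.2.2.2.2.1
      have h3 : 0 < ‖g₁ η‖ := norm_pos_iff.2 h2
      linarith
    refine ⟨ρ₀, hρ₀, fun η hη0 hη => ?_, fun ρ hρ hρρ₀ => ?_⟩
    · rw [hfac η hη]
      exact mul_ne_zero (hσ'ne η hη0 (hTmem η hη).2.2.2.2.2.2.2) (hgne η hη0 hη)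
    · -- the loops on the circle of radius `ρ`
      have hcirc : ∀ t, ‖circleLoop 0 ρ t‖ ≤ ρ₀ := fun t => by
        rw [norm_circleLoop_zero hρ]; exact hρρ₀
      have hcpos : ∀ t, 0 < ‖circleLoop 0 ρ t‖ := fun t => by rw [norm_circleLoop_zero hρ]; exact hρ
      have hTc : ∀ t, _ := fun t => hTmem (circleLoop 0 ρ t) (hcirc t)
      -- continuity of the factors along the circle
      have hσ'l : Continuous fun t => capFst p u' (circleLoop 0 ρ t) :=
        hσ'cont.comp_continuous (continuous_circleLoop 0 ρ) fun t =>
          mem_closedBall_zero_iff.2 (hTc t).2.2.2.2.2.2.2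
      have hW'l : Continuous fun t => capW p u' (circleLoop 0 ρ t) :=
        hW'c.continuousOn.comp_continuous (continuous_circleLoop 0 ρ) fun t =>
          mem_ball_zero_iff.2 (hTc t).2.2.2.2.2.1
      have hSl : Continuous fun t => capSlope p u r (capFst p u' (circleLoop 0 ρ t)) :=
        hslopeC.comp_continuous hσ'l fun t => (hTc t).1.1
      have hg₁l : Continuous fun t => g₁ (circleLoop 0 ρ t) :=
        hg₁D.continuousOn.comp_continuous (continuous_circleLoop 0 ρ) fun t =>
          mem_ball_zero_iff.2 (hTc t).2.2.2.1
      -- the loops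
      have hσ'loop : IsNonvanishingLoop fun t => capFst p u' (circleLoop 0 ρ t) :=
        ⟨hσ'l.continuousOn, fun t _ => hσ'ne _ (hcpos t) (hTc t).2.2.2.2.2.2.2,
          by simp [circleLoop_zero_eq]⟩
      have hg₁loop : IsNonvanishingLoop fun t => g₁ (circleLoop 0 ρ t) :=
        ⟨hg₁l.continuousOn, fun t _ => hg₁ne _ (hcpos t) (hTc t).2.2.2.2.2.2.1,
          by simp [circleLoop_zero_eq]⟩
      have hGl : IsNonvanishingLoop fun t =>
          capFst p u' (circleLoop 0 ρ t) * g₁ (circleLoop 0 ρ t) := hσ'loop.mul hg₁loop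
      have hfl : Continuous fun t => capFst p u' (circleLoop 0 ρ t) *
          (capW p u' (circleLoop 0 ρ t) - capSlope p u r (capFst p u' (circleLoop 0 ρ t))) :=
        hσ'l.mul (hW'l.sub hSl)
      have heqf : EqOn (fun t => capDefFn p u r (pencilCap p u' (circleLoop 0 ρ t)))
          (fun t => capFst p u' (circleLoop 0 ρ t) *
            (capW p u' (circleLoop 0 ρ t) - capSlope p u r (capFst p u' (circleLoop 0 ρ t))))
          (Icc 0 1) := fun t _ => hfac _ (hcirc t)
      have hclose : ∀ t ∈ Icc (0 : ℝ) 1,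
          ‖capFst p u' (circleLoop 0 ρ t) *
              (capW p u' (circleLoop 0 ρ t) - capSlope p u r (capFst p u' (circleLoop 0 ρ t))) -
            capFst p u' (circleLoop 0 ρ t) * g₁ (circleLoop 0 ρ t)‖ <
          ‖capFst p u' (circleLoop 0 ρ t) * g₁ (circleLoop 0 ρ t)‖ := fun t ht => by
        rw [← mul_sub, norm_mul, norm_mul]
        have hσpos : 0 < ‖capFst p u' (circleLoop 0 ρ t)‖ := norm_pos_iff.2 (hσ'loop.ne_zero t ht)
        refine mul_lt_mul_of_pos_left ?_ hσpos
        have h1 := hest _ (hcirc t)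
        have h2 : 0 < ‖g₁ (circleLoop 0 ρ t)‖ := norm_pos_iff.2 (hg₁loop.ne_zero t ht)
        linarith
      rw [wind_congr heqf, wind_eq_of_norm_sub_lt (f := fun t => capFst p u' (circleLoop 0 ρ t) *
          (capW p u' (circleLoop 0 ρ t) - capSlope p u r (capFst p u' (circleLoop 0 ρ t))))
        (g := fun t => capFst p u' (circleLoop 0 ρ t) * g₁ (circleLoop 0 ρ t))
        hfl.continuousOn (by simp [circleLoop_zero_eq]) hGl hclose, wind_mul hσ'loop hg₁loop,
        hσ'wind ρ hρ (le_trans hρρ₀ hρ₀σ), hg₁wind ρ hρ (le_trans hρρ₀ hρ₀g)]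
      ring

end IsPencilPlane

end Literature.Geometry.Symplectic
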